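import Summits.QuantumFields.BalabanUV.T4Continuum.Support.B13StepOfRecordSecantStructural
import Summits.QuantumFields.BalabanUV.T4Continuum.Support.B13StepOfRecordSub

/-!
# NE5 ∕ U3 — E8[rec] RE-POINTED OVER A MEASURABLE OPERATOR CARRIER (row owner's RULING R20 (i)), part 1 of 2: the two W2 producers of the
# secant route on BAŁABAN's GEOMETRY OF RECORD FOR ANY OPERATOR CARRIER `Op`, run A's history budget for ANY model reading an insertion
# datum, and the STRUCTURAL SECANT END for leaf-03's SLOTS OF RECORD OVER `Op` (`B13StepOfRecordSub.SlotsOn` ∕ `stepOn`)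

Cell `pub-balaban`, unit `b2b-balaban-t4-ne5-formalise-leaf-01` (NE5 formalisation swarm, LEAF PROVER 01, gen 6; journal INTENT l.11223, API
note l.11379; the follower R20 assigns to this lineage: «leaf-01∕leaf-03 re-point E8[rec]∕E9[rec] by followers when `B13StepOfRecordSub`
lands» — owner t4-ne5-p1-g29, journal l.11032).  A FOLLOWER of this lineage's `B13StepOfRecordSecantStructural` p214566 (E8[rec] structural on
`Op := OpDatum E`) consuming leaf-03-g6's `B13RepresentsOn` ∕ `B13StepOfRecordSub` (R20 (i): the assembly ∕ slots of record over an arbitrary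
operator carrier) BY NAME; nothing landed is edited.  Part 2 (`B13StepOfRecordSecantStructuralSub`) carries the faces for Bałaban's slots of
record RESTRICTED to a sub-slot `M ≤ OpDatum E` (of record `M := measOp`) with root `NE5 (B13StepOfRecord.outA S₀ E₀ cB) (B13StepOfRecord.outB
S₀ E₀ cB) …`.  Summits-side NEW WORK under the LEAN PLACEMENT RULE (cell bookkeeping; NOT a Literature module; 0 `def`, 0 cite tag).
HONEST FRAMING: rung (B)+1 of the FINITE-VOLUME T⁴ continuum programme — NOT infinite volume, NOT a mass gap, NOT the Clay problem, and
**NOT A PROOF OF NE5, NOR OF W2-op, NOR OF W2-ins**: both walls stay RELOCATED TO STRUCTURE exactly as in p214566 (operator half: the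
(H-rep)∕fibre dictionary at complex operator data — [Balaban1988RG2Cluster] (2.15)–(2.17) pp. 15–16 re-read, NOT PRINTED; insertion half:
table functional ∘ configuration map — KIND [Balaban1987RG1] (1.9)∕(1.18) pp. 261∕263, [Balaban1988RG2Cluster] Lemma 1 (1.34)∕(1.36) p. 9,
locators only); every other analytic input (W3 slice budgets; L05∕L06 quoted from [Balaban1987RG1] (1.18) p. 263, SHAPE, c4; W1 in row NE2's
currency; the insertion NE2-TYPE rate + reach; the per-activity structure ∕ exponent bounds ∕ majorants with decay split; the (2.38) SHAPES
— Lemma 3 (2.38) p. 20, locator only; radii; numerics) is a DISPLAYED HYPOTHESIS.  WHAT R20 CHANGES: NOT an estimate — the CARRIER on which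
the operator-line binder is displayed (over `ℓ^∞(E)` with `x`-indexed species it quantifies over directions with non-measurable `x`-sections,
G-ne5p2-5 class; over `↥measOp` over directions IN the measurable slot).  HONEST DEPENDENCY (cell line, verbatim): continuum YM on T⁴ ⇐
BetaPertH ∧ nine spine estimates (0/9 proved); BetaPertH ⇐ (D1) ∧ (D4) ∧ CAP+tail; G-an2-4 gates asym, D1 and NE2/3/4.

WHAT THIS FILE DOES.
* §1 (Bałaban's geometry of record, ANY normed operator carrier `Op`, ANY step model `M : StepModel R.carriers Op Hist` with
  `M.Out = out (labelsIndexing (domainGeometry R) (b13InnerData R)) (touchInc …) act`): **`histSecant_b13_anyCarrier_of_actNormDecay`** and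
  **`opLipschitz_b13_anyCarrier_of_actOpFibre`** — the two W2 producers of the secant route (leaf-03's `histSecant_socket_of_actNormDecay`;
  this lineage's `opLipschitz_socket_of_actNormDecay` ∘ the owner's `actOpBound_of_fibre`∕`actOpLip_of_fibre`, universal modulus `1∕(1 − ρ₀)`)
  with the geometry DISCHARGED by route P2's TR theorems (`ineq227_level` c = 5, `loc_b13`, `reach_b13` ν = 9) and the anchored norm
  `Φ₀ = ε·e^{64}·K₀(64,8)` PRODUCED from the (2.38) shape + rate room `64·log 162 + 64 ≤ Rt` (`anchoredNorm_b13`).  This lineage's record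
  lemmas `B13StepOfRecordSecantEnd.histSecant_step_of_actNormDecay` ∕ `…Structural.opLipschitz_record_of_actOpFibre` are the instance
  `M := B13StepOfRecord.step S E₀ cB`, `Op := OpDatum E`.
* §1b (ANY step model reading an insertion datum, ANY `Op`): `norm_baseA_sub_baseB_le_of_reads`, **`histBudgetA_of_reads`** — run A's
  history budget about a self-centred centre whose history component is run B's base part, from `ReadsA`∕`ReadsB` + the A-side slice
  budget (W3 KIND) + L05 + W4 read at the zero table (generic-model form of leaf-03's `B13StepSecantEnd.histBudgetA`; no new binder).
* §2 **`ne5_of_recordOn_secant_structural`** — E8[rec] STRUCTURAL FOR THE SLOTS OF RECORD OVER `Op` (`S : SlotsOn R Op IOp Hist`): the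
  Literature END `T4InputCauchyRateSecant.ne5_at_of_stepModel_secant_scale_nat` at `stepOn S E₀ cB` with L01∕L02∕L03, `HistPairInClass`,
  `InsAffine`∕`InsBlind`∕`InsHomog`∕`InsScaleBound` DISCHARGED by construction (leaf-03's `AssemblyOn` lemmas BY NAME + §1b), W4 PRODUCED from
  the owner's COMPOSITION shape on the insertion-operator species (`insOpEnvelope_of_composition` ∕ `insBoundA_of_composition` ∕
  `InsOpModel.insertionRate_of_insOp`), BOTH W2 halves PRODUCED by §1 from `ActOpFibre … S.act (stepOn S E₀ cB) W Aop` (operator lines IN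
  `Op`) and the history side's per-activity data; W1 DISPLAYED in margin units `OperatorRate W δ θ` (over an abstract `Op` the entry-currency
  junction needs a reading — part 2).  Root `NE5 (outA S E₀ cB) (outB S E₀ cB) W κ θ′ C₅`, p214566's constant at `c₁∕r₀ ↦ δ`.
Nothing is asserted about [II]'s kernels ∕ potentials ∕ terms (the slots, the structural shapes and the configuration data are PARAMETERS ∕
HYPOTHESES); nothing of print is discharged; 0 sorry; axioms ⊆ {propext, Classical.choice, Quot.sound}.
-/

noncomputable section

open scoped BigOperators
open Metric Set MeasureTheory

namespace Summit.QuantumFields.BalabanUV.T4Continuum.B13StepOfRecordSecantStructuralOn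

open Literature.MathematicalPhysics.QuantumFieldTheory.Balaban1983to89
open Literature.MathematicalPhysics.QuantumFieldTheory.Balaban1983to89.T4OutputRate (Carriers DecayBound NE5)
open Literature.MathematicalPhysics.QuantumFieldTheory.Balaban1983to89.T4InputCauchyRateData (StepModel)
open Literature.MathematicalPhysics.QuantumFieldTheory.Balaban1983to89.T4InputCauchyRateSpecies (ballClass OpLipschitz)
open Literature.MathematicalPhysics.QuantumFieldTheory.Balaban1983to89.T4InputCauchyRateSecant (HistSecant HistPairInClass
  histPairInClass_ballClass ne5_at_of_stepModel_secant_scale_nat)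
open Summit.QuantumFields.BalabanUV.T4Continuum.B13Carriers (TwoRuns)
open Summit.QuantumFields.BalabanUV.T4Continuum.B13StepTermLabels (InnerLabel)
open Summit.QuantumFields.BalabanUV.T4Continuum.B13StepTermFamily (ActData ActExpLinearOn out)
open Summit.QuantumFields.BalabanUV.T4Continuum.B13StepTermSocket (labelsIndexing touchInc)
open Summit.QuantumFields.BalabanUV.T4Continuum.B13InnerData (Bnd b13InnerData)
open Summit.QuantumFields.BalabanUV.T4Continuum.UrsellTermBudget (actSum)
open Summit.QuantumFields.BalabanUV.T4Continuum.B13TermHistSecant (ActExpNormBound ActAbsBound)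
open Summit.QuantumFields.BalabanUV.T4Continuum.B13TermHistSecantDecay (histSecant_socket_of_actNormDecay)
open Summit.QuantumFields.BalabanUV.T4Continuum.B13DomainGeometryTR (reach loc_b13 reach_b13 ineq227_level domainGeometry)
open Summit.QuantumFields.BalabanUV.T4Continuum.UrsellOfRecordFaces (anchoredNorm_b13 phi_nonneg)
open Summit.QuantumFields.BalabanUV.T4Continuum.B13StepOfRecordSecantTermwise (opLipschitz_socket_of_actNormDecay)
open Summit.QuantumFields.BalabanUV.T4Continuum.OutputRateActOpFibre (ActOpFibre actOpBound_of_fibre actOpLip_of_fibre)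
open Summit.QuantumFields.BalabanUV.T4Continuum.B13StepOfRecordSecantStructural (modulus_nonneg)
open Summit.QuantumFields.BalabanUV.T4Continuum.B13Base (selfCtr)
open Summit.QuantumFields.BalabanUV.T4Continuum.B13StepEndInsOp (deltaIns_nonneg)
open Summit.QuantumFields.BalabanUV.T4Continuum.OutputRateInsertion (InsOpModel)
open Summit.QuantumFields.BalabanUV.T4Continuum.OutputRateInsertionStructural (InsOpComposition insOpEnvelope_of_composition
  insBoundA_of_composition)
open Summit.QuantumFields.BalabanUV.T4Continuum.B13RepresentsOn (AssemblyOn)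
open Summit.QuantumFields.BalabanUV.T4Continuum.B13StepOfRecordSub (SlotsOn assemblyOn stepOn)

/-! ## §1 The two W2 producers of the secant route on Bałaban's geometry of record, ANY operator carrier -/

section AnyCarrier

variable {𝔾 : Type} [GaugeGroup 𝔾] {R : TwoRuns 𝔾} {Op Hist Ω : Type*} [NormedAddCommGroup Op] [NormedSpace ℂ Op]
  [NormedAddCommGroup Hist] [NormedSpace ℂ Hist] [MeasurableSpace Ω]
  {act : R.carriers.Dom → InnerLabel R.carriers.Dom (Bnd R) → Op → Hist → ℂ} {M : StepModel R.carriers Op Hist}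

/-- [folklore] **THE HISTORY SECANT ON BAŁABAN's GEOMETRY OF RECORD FOR ANY OPERATOR CARRIER.**  leaf-03's
`histSecant_socket_of_actNormDecay` at ANY step model `M : StepModel R.carriers Op Hist` whose output is the Ursell series of the
socket of record, `M.Out = out (labelsIndexing (domainGeometry R) (b13InnerData R)) (touchInc …) act`, over ANY normed operator
carrier `Op` (of record after R20: `Op := ↥measOp`, cores `act` read through the inclusion), with the geometry DISCHARGED by route
P2's TR theorems (`h227 := ineq227_level`, c = 5; `hloc := loc_b13`; `hreach := reach_b13`, ν = 9) and the anchored exponential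
norm `Φ₀ = ε·e^{64}·K₀(64,8)` PRODUCED from the (2.38)-shaped polymer sums of the stripped majorant + rate room (`anchoredNorm_b13`):
structure `ActExpLinearOn`, exponent bounds `0 ≤ N ≤ N̄`, absolute majorants `A ≤ A′e^{−κ(d+5)}`, (2.38) shape of `A′`, `36Φ₀ < 1` ⟹
`HistSecant M K W κ (2·(N̄·Φ₀∕(1 − 36Φ₀)²))`.  (This lineage's `B13StepOfRecordSecantEnd.histSecant_step_of_actNormDecay` is the
instance `M := B13StepOfRecord.step S E₀ cB`, `Op := OpDatum E`.) -/
theorem histSecant_b13_anyCarrier_of_actNormDecay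
    (hM : ∀ k o h X, M.Out k o h X = out (labelsIndexing (domainGeometry R) (b13InnerData R)) (touchInc (domainGeometry R)) act k o h X)
    {K : ℕ → (ℕ → ℝ) → R.carriers.BgB → Set (Op × Hist)} {W : Set (ℕ → ℝ)}
    {N A A' : ℕ → (ℕ → ℝ) → R.carriers.BgB → R.carriers.Dom → InnerLabel R.carriers.Dom (Bnd R) → ℝ} {Nbar κ ε Rt : ℝ}
    {Dt : ActData R.carriers.Dom (InnerLabel R.carriers.Dom (Bnd R)) Op Hist Ω} (hκ : 0 ≤ κ)
    (hexp : ActExpLinearOn (labelsIndexing (domainGeometry R) (b13InnerData R)) act Dt K W)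
    (hN : ActExpNormBound (labelsIndexing (domainGeometry R) (b13InnerData R)) Dt K W M.rHist N)
    (hN0 : ∀ k g U Z ℓ, 0 ≤ N k g U Z ℓ) (hNle : ∀ k g U Z ℓ, N k g U Z ℓ ≤ Nbar) (hNbar : 0 ≤ Nbar)
    (habs : ActAbsBound (labelsIndexing (domainGeometry R) (b13InnerData R)) Dt K W A)
    (hA0 : ∀ k g U Z ℓ, 0 ≤ A k g U Z ℓ) (hA0' : ∀ k g U Z ℓ, 0 ≤ A' k g U Z ℓ)
    (hdec : ∀ k g U Z ℓ, A k g U Z ℓ ≤ A' k g U Z ℓ * Real.exp (-(κ * (R.carriers.d Z + 5)))) (hε : 0 ≤ ε)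
    (h238 : ∀ k, ∀ g ∈ W, ∀ (U : R.carriers.BgB), ∀ Z ∈ R.domAt k,
      actSum (b13InnerData R) (A' k g U) k Z ≤ ε * Real.exp (-(Rt * R.carriers.d Z)))
    (hRt : 64 * Real.log 162 + 64 ≤ Rt) (hΦsmall : 36 * (ε * Real.exp 64 * B12TreeDecay.K₀ (4 * 2 ^ 4) (2 * 4)) < 1) :
    HistSecant M K W κ (2 * (Nbar * ((ε * Real.exp 64 * B12TreeDecay.K₀ (4 * 2 ^ 4) (2 * 4)) /
      (1 - 36 * (ε * Real.exp 64 * B12TreeDecay.K₀ (4 * 2 ^ 4) (2 * 4))) ^ 2))) := by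
  have h := histSecant_socket_of_actNormDecay (G := domainGeometry R) (D := b13InnerData R) (act := act) (M := M) (K := K)
    (W := W) (N := N) (𝒜 := A) (𝒜' := A') (ν := 9) (Φ' := ε * Real.exp 64 * B12TreeDecay.K₀ (4 * 2 ^ 4) (2 * 4)) (c := 5)
    hM hκ (by norm_num : (0 : ℝ) ≤ 5) hexp hN hN0 hNle hNbar habs hA0 hA0' hdec (fun X => ineq227_level X) reach
    (fun Z Z' h => loc_b13 Z Z' h) (by norm_num) reach_b13 (phi_nonneg hε) (by linarith)
    (fun k g hg U q => anchoredNorm_b13 R hε (h238 k g hg U) hRt q)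
  have h36 : (4 : ℝ) * 9 * (ε * Real.exp 64 * B12TreeDecay.K₀ (4 * 2 ^ 4) (2 * 4)) =
      36 * (ε * Real.exp 64 * B12TreeDecay.K₀ (4 * 2 ^ 4) (2 * 4)) := by ring
  rwa [h36] at h

/-- [folklore] **`OpLipschitz` ON BAŁABAN's GEOMETRY OF RECORD FOR ANY OPERATOR CARRIER, FROM THE FIBRE SHAPE.**  This lineage's
`opLipschitz_socket_of_actOpFibre` (the owner's structural shape `ActOpFibre … act M W Aop` — each (2.14) factor complex differentiable
and bounded by `Aop` along every complex operator line IN `Op` within the operator margin; NOT PRINTED, KIND [Balaban1988RG2Cluster]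
(2.15)–(2.17) pp. 15–16 at complex operator data — and `0 ≤ ρ₀ < 1`, universal relative modulus `1∕(1 − ρ₀)`) at ANY step model on the
socket of record over ANY operator carrier `Op`, geometry DISCHARGED as above: `OpLipschitz M W κ ((1∕(1−ρ₀))·Φ₀∕(1−36Φ₀)²) ρ₀`,
`Φ₀ = εop·e^{64}·K₀(64,8)`.  Over `Op := ↥measOp` the operator LINES `p.1 + ζ•u` stay inside the measurable carrier — the point of
R20 (i): the binder is satisfiable for x-indexed cores, which it is not over `ℓ^∞`. -/
theorem opLipschitz_b13_anyCarrier_of_actOpFibre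
    (hM : ∀ k o h X, M.Out k o h X = out (labelsIndexing (domainGeometry R) (b13InnerData R)) (touchInc (domainGeometry R)) act k o h X)
    {W : Set (ℕ → ℝ)} {Aop Aop' : ℕ → (ℕ → ℝ) → R.carriers.BgB → R.carriers.Dom → InnerLabel R.carriers.Dom (Bnd R) → ℝ}
    {ρ₀ κ εop Rt : ℝ} (hρ₀ : 0 ≤ ρ₀) (hρ₀1 : ρ₀ < 1) (hκ : 0 ≤ κ)
    (hfib : ActOpFibre (labelsIndexing (domainGeometry R) (b13InnerData R)) act M W Aop)
    (hAop0 : ∀ k g U Z ℓ, 0 ≤ Aop k g U Z ℓ) (hAop0' : ∀ k g U Z ℓ, 0 ≤ Aop' k g U Z ℓ)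
    (hdecop : ∀ k g U Z ℓ, Aop k g U Z ℓ ≤ Aop' k g U Z ℓ * Real.exp (-(κ * (R.carriers.d Z + 5)))) (hεop : 0 ≤ εop)
    (h238op : ∀ k, ∀ g ∈ W, ∀ (U : R.carriers.BgB), ∀ Z ∈ R.domAt k,
      actSum (b13InnerData R) (Aop' k g U) k Z ≤ εop * Real.exp (-(Rt * R.carriers.d Z)))
    (hRt : 64 * Real.log 162 + 64 ≤ Rt) (hΦopsmall : 36 * (εop * Real.exp 64 * B12TreeDecay.K₀ (4 * 2 ^ 4) (2 * 4)) < 1) :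
    OpLipschitz M W κ (1 / (1 - ρ₀) * ((εop * Real.exp 64 * B12TreeDecay.K₀ (4 * 2 ^ 4) (2 * 4)) /
      (1 - 36 * (εop * Real.exp 64 * B12TreeDecay.K₀ (4 * 2 ^ 4) (2 * 4))) ^ 2)) ρ₀ := by
  have h := opLipschitz_socket_of_actNormDecay (domainGeometry R) (b13InnerData R) act (M := M) hM
    (N := fun _ _ _ _ _ => 1 / (1 - ρ₀)) (ν := 9) (Φ' := εop * Real.exp 64 * B12TreeDecay.K₀ (4 * 2 ^ 4) (2 * 4)) (c := 5)
    hρ₀ hκ (by norm_num) (actOpBound_of_fibre hfib hρ₀1.le) (actOpLip_of_fibre hfib hρ₀1)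
    (fun _ _ _ _ _ => modulus_nonneg hρ₀1.le) (fun _ _ _ _ _ => le_rfl) (modulus_nonneg hρ₀1.le) hAop0 hAop0' hdecop
    (fun X => ineq227_level X) reach (fun Z Z' h => loc_b13 Z Z' h) (by norm_num) reach_b13 (phi_nonneg hεop) (by linarith)
    (fun k g hg U q => anchoredNorm_b13 R hεop (h238op k g hg U) hRt q)
  have h36 : (4 : ℝ) * 9 * (εop * Real.exp 64 * B12TreeDecay.K₀ (4 * 2 ^ 4) (2 * 4)) =
      36 * (εop * Real.exp 64 * B12TreeDecay.K₀ (4 * 2 ^ 4) (2 * 4)) := by ring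
  rwa [h36] at h

end AnyCarrier

/-! ## §1b Run A's history budget about a self-centred centre for ANY step model reading an insertion datum (generic `Op`) -/

section AnyModel

variable {C : Carriers} {IOp Op Hist : Type*} [NormedAddCommGroup Op] [NormedSpace ℂ Op] [NormedAddCommGroup Hist]
  [NormedSpace ℂ Hist] {D : B13HistInsertion.InsDatum C IOp Hist} {M : StepModel C Op Hist} {W : Set (ℕ → ℝ)}

/-- [folklore] **THE BASE-PART DISCREPANCY FROM W4, FOR ANY MODEL READING THE DATUM**: the displayed insertion rate
`M.InsertionRate W κ E₀ δ′ θ` (`0 ≤ E₀`, `0 ≤ δ′`, `0 ≤ θ ≤ 1`), read at the ZERO table through both readings `ReadsA`∕`ReadsB`, bounds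
the distance of the two runs' base parts: `‖baseA − baseB‖ ≤ δ′·rHist k` (the generic-model form of leaf-03's
`B13StepSecantEnd.norm_baseA_sub_histRef_le`; no new binder). -/
theorem norm_baseA_sub_baseB_le_of_reads {κ E₀ δ' θ : ℝ} (hA : D.ReadsA M W) (hB : D.ReadsB M W)
    (hins : M.InsertionRate W κ E₀ δ' θ) (hE₀ : 0 ≤ E₀) (hδ' : 0 ≤ δ') (hθ : 0 ≤ θ) (hθ1 : θ ≤ 1)
    (k : ℕ) {g : ℕ → ℝ} (hg : g ∈ W) (U : C.BgB) :
    ‖B13BaseInsDatum.baseA D g U k - B13BaseInsDatum.baseB D g U k‖ ≤ δ' * M.rHist k := by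
  have h := hins k g hg U 0 fun Y => by
    rw [Pi.zero_apply, abs_zero]; exact mul_nonneg hE₀ (Real.exp_pos _).le
  rw [hA k g hg U, hB k g hg U] at h
  have hA0 : D.insA g U k 0 = B13BaseInsDatum.baseA D g U k := B13StepSecantEnd.ins_zero D k _
  have hB0 : D.insB g U k 0 = B13BaseInsDatum.baseB D g U k := B13StepSecantEnd.ins_zero D k _
  rw [hA0, hB0] at h
  refine h.trans ?_
  have hr := (M.rHist_pos k).le
  calc δ' * θ ^ k * M.rHist k ≤ δ' * 1 * M.rHist k :=
        mul_le_mul_of_nonneg_right (mul_le_mul_of_nonneg_left (pow_le_one₀ hθ hθ1) hδ') hr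
    _ = δ' * M.rHist k := by ring

/-- [folklore] **RUN A's HISTORY BUDGET ABOUT A SELF-CENTRED CENTRE WHOSE HISTORY COMPONENT IS RUN B's BASE PART, FOR ANY MODEL
READING THE DATUM**: `ReadsA`∕`ReadsB`, the DISPLAYED A-side slice budget `SliceBudget κ cA` (W3 KIND), the quoted level
`DecayBound EA W EA₀ κ` (L05) and W4 at the zero table ⟹ `HistBudgetA M ctr EA W (k ↦ δ′·rHist k + EA₀·rHist k·cA∕(1 − ω))` for every
centre `ctr` with `(ctr k g U).2 = baseB D g U k` (`B13BaseInsDatum.histBudgetA_of_insDatum`; generic-model form of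
`B13StepSecantEnd.histBudgetA`). -/
theorem histBudgetA_of_reads {EA : T4OutputRate.Functional C C.BgA} {ctr : ℕ → (ℕ → ℝ) → C.BgB → Op × Hist}
    {κ EA₀ E₀ cA δ' θ : ℝ} (hctr : ∀ k g U, (ctr k g U).2 = B13BaseInsDatum.baseB D g U k) (hA : D.ReadsA M W) (hB : D.ReadsB M W)
    (hbA : D.SliceBudget M W κ cA) (hdA : DecayBound EA W EA₀ κ) (hins : M.InsertionRate W κ E₀ δ' θ) (hEA₀ : 0 ≤ EA₀)
    (hE₀ : 0 ≤ E₀) (hcA : 0 ≤ cA) (hδ' : 0 ≤ δ') (hθ : 0 ≤ θ) (hθ1 : θ ≤ 1) (hω : 0 ≤ D.ω) (hω1 : D.ω < 1) :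
    T4InputCauchyRateSecant.HistBudgetA M ctr EA W fun k => δ' * M.rHist k + EA₀ * (M.rHist k * (cA / (1 - D.ω))) :=
  B13BaseInsDatum.histBudgetA_of_insDatum hA hbA hdA hEA₀ hcA hω hω1 fun k _ hg U => by
    rw [hctr]; exact norm_baseA_sub_baseB_le_of_reads hA hB hins hE₀ hδ' hθ hθ1 k hg U

end AnyModel

/-! ## §2 E8[rec] structural for the slots of record OVER AN ARBITRARY OPERATOR CARRIER (W1 displayed in margin units) -/

section RecordOn

variable {𝔾 : Type} [GaugeGroup 𝔾] {R : TwoRuns 𝔾} {Op IOp Hist Ω : Type*} [NormedAddCommGroup Op] [NormedSpace ℂ Op]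
  [NormedAddCommGroup Hist] [NormedSpace ℂ Hist] [CompleteSpace Hist] [NormedAddCommGroup IOp] [NormedSpace ℂ IOp] [MeasurableSpace Ω]
  (S : SlotsOn R Op IOp Hist) (E₀ cB : ℝ)

/-- [folklore] **E8[rec] STRUCTURAL OVER AN ARBITRARY OPERATOR CARRIER `Op`.**  For leaf-03's slots of record over `Op` and its step model
`stepOn S E₀ cB` (output = the Ursell series of the socket of record with cores `S.act : … → Op → Hist → ℂ`; base = the self-centred budget
box): the transport READING; the DISPLAYED one-run slice budgets of both runs (W3 KIND); the quoted levels L05∕L06 for `outA`∕`outB`; W1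
DISPLAYED in margin units `OperatorRate W δ θ` (row NE2's residual read in `Op`; the entry-currency junction along a reading is §3); W2-ins as
the owner's COMPOSITION shape `InsOpComposition` on the insertion-operator species + run A's datum in the operator domain + the insertion
NE2-TYPE rate and reach; W2-op as the owner's FIBRE shape **`ActOpFibre … S.act (stepOn S E₀ cB) W Aop` — operator lines IN `Op`** — with decay
split and (2.38) shape of the stripped operator majorant; the history side's per-activity STRUCTURE `ActExpLinearOn`, exponent bounds
`0 ≤ N ≤ N̄`, absolute majorants with decay split and (2.38) shape, ONE rate room; the RADII; the numerics ⟹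
`NE5 (outA S E₀ cB) (outB S E₀ cB) W κ θ′ C₅` with p214566's constant at `c₁∕r₀ ↦ δ`.  L01∕L02∕L03, `HistPairInClass`, the insertion
structure binders and `InsScaleBound` are DISCHARGED inside by leaf-03's `AssemblyOn` lemmas and §1b; both W2 halves by §1.  NOT a proof of
NE5: an implication from displayed binders. -/
theorem ne5_of_recordOn_secant_structural {W : Set (ℕ → ℝ)} {ROp RHist : ℕ → ℝ}
    {N A A' Aop Aop' : ℕ → (ℕ → ℝ) → R.carriers.BgB → R.carriers.Dom → InnerLabel R.carriers.Dom (Bnd R) → ℝ}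
    {Dt : ActData R.carriers.Dom (InnerLabel R.carriers.Dom (Bnd R)) Op Hist Ω}
    {κ Nbar ε εop Rt EA₀ E₁ cA δ Gi δI ρ₁ θ θ' ρ₀ B : ℝ} {k₀ k₁ : ℕ} (rI : ℕ → ℝ) (hrI : ∀ k, 0 < rI k)
    {Cfg : ℕ → Type*} [∀ k, NormedAddCommGroup (Cfg k)] [∀ k, NormedSpace ℂ (Cfg k)] {cfg : ∀ k, IOp → Cfg k}
    {Φ : ∀ k, (R.carriers.Dom → ℝ) → Cfg k → Hist} {𝒪 : ℕ → (ℕ → ℝ) → R.carriers.BgB → Set IOp}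
    {Dc : ∀ k, (ℕ → ℝ) → R.carriers.BgB → Set (Cfg k)}
    (hT : (assemblyOn S).TransportReads W)
    (hbB : (assemblyOn S).SliceBudgetB W κ cB) (hbA : S.D.SliceBudget (stepOn S E₀ cB) W κ cA)
    (hdA : DecayBound (B13StepOfRecordSub.outA S E₀ cB) W EA₀ κ) (hdB : DecayBound (B13StepOfRecordSub.outB S E₀ cB) W E₀ κ)
    (hop : (stepOn S E₀ cB).OperatorRate W δ θ)
    (hcomp : InsOpComposition (S.D.toInsOpModel (stepOn S E₀ cB) rI hrI) W κ E₀ Gi cfg Φ 𝒪 Dc)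
    (hIA : ∀ k, ∀ g ∈ W, ∀ (U : R.carriers.BgB), (S.D.toInsOpModel (stepOn S E₀ cB) rI hrI).opIA g U k ∈ 𝒪 k g U)
    (hirate : (S.D.toInsOpModel (stepOn S E₀ cB) rI hrI).InsOpRate W δI θ) (hδI : 0 ≤ δI) (hGi : 0 ≤ Gi) (hρ₁ : ρ₁ < 1)
    (hreachI : δI * θ ^ k₁ ≤ ρ₁)
    (hfib : ActOpFibre (labelsIndexing (domainGeometry R) (b13InnerData R)) S.act (stepOn S E₀ cB) W Aop)
    (hAop0 : ∀ k g U Z ℓ, 0 ≤ Aop k g U Z ℓ) (hAop0' : ∀ k g U Z ℓ, 0 ≤ Aop' k g U Z ℓ)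
    (hdecop : ∀ k g U Z ℓ, Aop k g U Z ℓ ≤ Aop' k g U Z ℓ * Real.exp (-(κ * (R.carriers.d Z + 5)))) (hεop : 0 ≤ εop)
    (h238op : ∀ k, ∀ g ∈ W, ∀ (U : R.carriers.BgB), ∀ Z ∈ R.domAt k,
      actSum (b13InnerData R) (Aop' k g U) k Z ≤ εop * Real.exp (-(Rt * R.carriers.d Z)))
    (hΦopsmall : 36 * (εop * Real.exp 64 * B12TreeDecay.K₀ (4 * 2 ^ 4) (2 * 4)) < 1)
    (hexp : ActExpLinearOn (labelsIndexing (domainGeometry R) (b13InnerData R)) S.act Dt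
      (ballClass (selfCtr (assemblyOn S).raw (assemblyOn S).histRef) ROp RHist) W)
    (hN : ActExpNormBound (labelsIndexing (domainGeometry R) (b13InnerData R)) Dt
      (ballClass (selfCtr (assemblyOn S).raw (assemblyOn S).histRef) ROp RHist) W S.rHist N)
    (hN0 : ∀ k g U Z ℓ, 0 ≤ N k g U Z ℓ) (hNle : ∀ k g U Z ℓ, N k g U Z ℓ ≤ Nbar) (hNbar : 0 ≤ Nbar)
    (habs : ActAbsBound (labelsIndexing (domainGeometry R) (b13InnerData R)) Dt
      (ballClass (selfCtr (assemblyOn S).raw (assemblyOn S).histRef) ROp RHist) W A)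
    (hA0 : ∀ k g U Z ℓ, 0 ≤ A k g U Z ℓ) (hA0' : ∀ k g U Z ℓ, 0 ≤ A' k g U Z ℓ) (hκ : 0 ≤ κ)
    (hdec : ∀ k g U Z ℓ, A k g U Z ℓ ≤ A' k g U Z ℓ * Real.exp (-(κ * (R.carriers.d Z + 5))))
    (hε : 0 ≤ ε)
    (h238 : ∀ k, ∀ g ∈ W, ∀ (U : R.carriers.BgB), ∀ Z ∈ R.domAt k,
      actSum (b13InnerData R) (A' k g U) k Z ≤ ε * Real.exp (-(Rt * R.carriers.d Z)))
    (hRt : 64 * Real.log 162 + 64 ≤ Rt) (hΦsmall : 36 * (ε * Real.exp 64 * B12TreeDecay.K₀ (4 * 2 ^ 4) (2 * 4)) < 1)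
    (hOp : ∀ k, δ * S.rOp k ≤ ROp k) (hHist : ∀ k, (assemblyOn S).bHist E₀ cB k ≤ RHist k)
    (hHistA : ∀ k, (Gi * δI / (1 - ρ₁) + 2 * Gi / θ ^ k₁) * S.rHist k + EA₀ * (S.rHist k * (cA / (1 - S.D.ω))) ≤ RHist k)
    (hEA₀ : 0 ≤ EA₀) (hE₀ : 0 ≤ E₀) (hE₁ : 0 < E₁) (hcA : 0 ≤ cA) (hcB : 0 ≤ cB) (hδ : 0 ≤ δ)
    (hθ0 : 0 < θ) (hθθ' : θ ≤ θ') (hθ'1 : θ' ≤ 1) (hω : 0 < S.D.ω)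
    (hω1 : S.D.ω < 1) (hρ₀ : 0 ≤ ρ₀) (hρ₀1 : ρ₀ < 1) (hreach : δ * θ ^ k₀ ≤ ρ₀) (hB : 0 ≤ B) (hfirst : ∀ k < k₀, EA₀ + E₀ ≤ B * θ ^ k)
    (hsmall : S.D.ω + 2 * (Nbar * ((ε * Real.exp 64 * B12TreeDecay.K₀ (4 * 2 ^ 4) (2 * 4)) /
          (1 - 36 * (ε * Real.exp 64 * B12TreeDecay.K₀ (4 * 2 ^ 4) (2 * 4))) ^ 2)) * cA < θ') :
    NE5 (B13StepOfRecordSub.outA S E₀ cB) (B13StepOfRecordSub.outB S E₀ cB) W κ θ'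
      (((1 / (1 - ρ₀) * ((εop * Real.exp 64 * B12TreeDecay.K₀ (4 * 2 ^ 4) (2 * 4)) /
          (1 - 36 * (εop * Real.exp 64 * B12TreeDecay.K₀ (4 * 2 ^ 4) (2 * 4))) ^ 2)) * δ + 2 * (Nbar * ((ε * Real.exp 64 * B12TreeDecay.K₀ (4 * 2 ^ 4) (2 * 4)) /
          (1 - 36 * (ε * Real.exp 64 * B12TreeDecay.K₀ (4 * 2 ^ 4) (2 * 4))) ^ 2)) *
          (Gi * δI / (1 - ρ₁) + 2 * Gi / θ ^ k₁) + B) * (θ' - S.D.ω) /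
        (θ' - (S.D.ω + 2 * (Nbar * ((ε * Real.exp 64 * B12TreeDecay.K₀ (4 * 2 ^ 4) (2 * 4)) /
          (1 - 36 * (ε * Real.exp 64 * B12TreeDecay.K₀ (4 * 2 ^ 4) (2 * 4))) ^ 2)) * cA))) := by
  have hθ1 : θ ≤ 1 := hθθ'.trans hθ'1
  have hδ' := deltaIns_nonneg (k₁ := k₁) hGi hδI hθ0 hρ₁
  have hΛop : 0 ≤ (1 / (1 - ρ₀) * ((εop * Real.exp 64 * B12TreeDecay.K₀ (4 * 2 ^ 4) (2 * 4)) /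
          (1 - 36 * (εop * Real.exp 64 * B12TreeDecay.K₀ (4 * 2 ^ 4) (2 * 4))) ^ 2)) :=
    mul_nonneg (modulus_nonneg hρ₀1.le) (div_nonneg (phi_nonneg hεop) (sq_nonneg _))
  have hG₁ : 0 ≤ 2 * (Nbar * ((ε * Real.exp 64 * B12TreeDecay.K₀ (4 * 2 ^ 4) (2 * 4)) /
          (1 - 36 * (ε * Real.exp 64 * B12TreeDecay.K₀ (4 * 2 ^ 4) (2 * 4))) ^ 2)) :=
    mul_nonneg zero_le_two (mul_nonneg hNbar (div_nonneg (phi_nonneg hε) (sq_nonneg _)))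
  -- L03 and W4 (PRODUCED from the composition shape), by construction ∕ by name
  have hbase := AssemblyOn.inBase (𝔄 := assemblyOn S) hbB hdB hE₀ hcB hω.le hω1
  have hins : (stepOn S E₀ cB).InsertionRate W κ E₀ (Gi * δI / (1 - ρ₁) + 2 * Gi / θ ^ k₁) θ :=
    InsOpModel.insertionRate_of_insOp _ ((assemblyOn S).readsIns _ rI hrI W) (insOpEnvelope_of_composition hcomp)
      (insBoundA_of_composition hcomp hIA) hirate hδI hθ0 hθ1 hρ₁ hreachI
  -- the history leg's endpoints lie in the budget ball class (budgets + W1 + W4 at the zero table, §1b)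
  have hpair : HistPairInClass (stepOn S E₀ cB) (ballClass (selfCtr (assemblyOn S).raw (assemblyOn S).histRef) ROp RHist)
      (B13StepOfRecordSub.outA S E₀ cB) (B13StepOfRecordSub.outB S E₀ cB) W :=
    histPairInClass_ballClass hbase ((assemblyOn S).baseBudget _ W)
      (histBudgetA_of_reads (D := S.D) (fun _ _ _ => rfl) ((assemblyOn S).readsA _ W) ((assemblyOn S).readsB _ W) hbA hdA hins
        hEA₀ hE₀ hcA hδ' hθ0.le hθ1 hω.le hω1)
      hop hδ hθ0.le hθ1 (fun k => by rw [Pi.zero_apply, zero_add]; exact hOp k) hHist hHistA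
  -- BOTH halves of W2 PRODUCED on Bałaban's geometry over the carrier `Op` (§1, `hM := rfl`)
  have hopL := opLipschitz_b13_anyCarrier_of_actOpFibre (R := R) (M := stepOn S E₀ cB) (act := S.act) (fun _ _ _ _ => rfl)
    hρ₀ hρ₀1 hκ hfib hAop0 hAop0' hdecop hεop h238op hRt hΦopsmall
  have hsec := histSecant_b13_anyCarrier_of_actNormDecay (R := R) (M := stepOn S E₀ cB) (act := S.act) (fun _ _ _ _ => rfl)
    hκ hexp hN hN0 hNle hNbar habs hA0 hA0' hdec hε h238 hRt hΦsmall
  exact ne5_at_of_stepModel_secant_scale_nat (stepOn S E₀ cB) ((assemblyOn S).representsA _ hT) ((assemblyOn S).representsB _ W)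
    hbase hpair hopL hsec hdA hdB hop hins ((assemblyOn S).insAffine _ W) ((assemblyOn S).insBlind _ W)
    ((assemblyOn S).insHomog _ W) (AssemblyOn.insScaleBound hbA hω.le hE₁.le) hE₁ hΛop hG₁ hδ hδ' hθ0.le hθθ' hθ'1 hcA hω hreach
    hB hfirst hsmall

end RecordOn


end Summit.QuantumFields.BalabanUV.T4Continuum.B13StepOfRecordSecantStructuralOn

end
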